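import Literature.NumberTheory.Automorphic.UnitaryGroupTorusMeasureCoherence
import Literature.NumberTheory.Automorphic.UnitaryGroupTorusCompactCoreLevel
import Literature.NumberTheory.Automorphic.CanonicalTorusMeasureTransport
import HarnessLib

/-!
# Coherence of the adelic torus measures of two stably conjugate regular classes, FROM THE KIT's FACTS
(Rogawski (1990) §4.3 pp. 43–44, §14.5 pp. 237–238; Langlands–Shelstad (1987) §1.3)

Topic `NumberTheory/Automorphic`; namespaces `Literature.NumberTheory.Automorphic` (§1, generic) and `….UnitaryGroup` (§2).  THEOREMS ONLY (no
definition, no instance, no named fact, no `sorry`).  Cell `pub/hodgecm-mathlib`, ENGINE T1 (crux item stmt-HodgeConjecture-24833), row (O10-c4-b) of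
F0P3a-plan RULING #104 (3)(a) ∕ #105 (1): the PAIR step of «the β-socket weights are constant on regular stable classes» (ED 1.22 pin (viii⁵)).

★ (δ4-CM) `UnitaryGroup.map_adelicStableCentralizerEquiv_torusMeasure_eq` (A-p06) transports the adelic torus measure `t_𝔸` of the tower at `γ ⊗ 1`
to `t′_𝔸` at `γ′ ⊗ 1` along ★ `adelicStableCentralizerEquiv`, GIVEN seven coherence inputs `hQ hK hK′ Pa hPam ha hPa`.  This file DISCHARGES them from
the facts the kit (pins (xi‴)(xii) of the T1 line) and the tree supply, leaving only the archimedean coherence `ha` in ★ `archStableCentralizerEquiv`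
form (= pin (xii) (C′) + `Measure.map_smul`, via ★ `OrbitalMeasureQuotientOfPointHaarChange`):

* §1 `map_eq_of_apply_compactCore_eq_one'` — ★ δ1 `map_eq_of_apply_compactCore_eq_one` WITHOUT its «compact open compact core» hypotheses: two
  Haar measures on the target are proportional (Mathlib `isMulLeftInvariant_eq_smul`) and both give the compact core outer measure `1`
  (★ `image_compactCore`), so `e_* t = t′` for EVERY isomorphism `e` — the `hQ` of (δ4-CM) at EVERY finite place from the canonical
  normalisation alone.
* §2 **`UnitaryGroup.map_adelicStableCentralizerEquiv_torusMeasure_eq_of_compactCore`** — (δ4-CM)'s two-tower telescope VERBATIM (so it eats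
  two outputs of the per-class kit instantiation ★-to-be `UnitaryGroupOfLocalTorusMeasureKit` by `obtain`), with `hQ` ⇐ §1 from
  `ht1c ht1c′ : ∀ v, t v (compactCore) = 1`, `hK hK′` ⇐ ★ `eventually_inH_localInt_eq_compactCore` from `hF hF′ : CompactCoreCentralizerLevelAE`
  (★ `compactCoreCentralizerLevelAE_of_hermitian`), `Pa := archStableCentralizerEquiv L hH hH′ hc∞ h∞` at the points `(γ ⊗ 1)_∞`, `(γ′ ⊗ 1)_∞`,
  `hPam` its continuity, `hPa` ⇐ ★ `archPart_adelicStableCentralizerEquiv` + ★ `coe_archStableCentralizerEquiv_eq_of_conj_eq` (base-point change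
  ★ `archPart_cmDatum_toAdelic`).  The covolume head `covol (νZ c) = covol (νZ c′)` is then ★-to-be (c3) reader
  `UnitaryGroupCovolWeightStable` §2 (F0P4-p03) applied to this conclusion.

## References
* J. D. Rogawski, *Automorphic Representations of Unitary Groups in Three Variables*, Ann. of Math. Stud. 123 (1990), §4.3 pp. 43–44, §14.5 pp. 237–238
  [Rogawski1990].
* R. P. Langlands, D. Shelstad, *On the definition of transfer factors*, Math. Ann. 278 (1987), §1.3 [LanglandsShelstad1987].
-/

set_option autoImplicit false

noncomputable section

open _root_.MeasureTheory _root_.MeasureTheory.Measure Set Filter Function NumberField IsDedekindDomain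
open _root_.Topology
open Literature.Topology.RestrictedProduct Literature.Topology.Algebra.RestrictedProduct Literature.MeasureTheory.Group
open Literature.MeasureTheory.RestrictedProduct Literature.NumberTheory.Rogawski1990
open scoped RestrictedProduct ENNReal NNReal Pointwise Matrix MatrixGroups

namespace Literature.NumberTheory.Automorphic

/-! ## §1 Canonically normalised torus measures correspond under ANY isomorphism (no «compact open core» needed) -/

section TransportOne

variable {Z Z' : Type*} [Group Z] [Group Z'] [TopologicalSpace Z] [TopologicalSpace Z'] [IsTopologicalGroup Z] [IsTopologicalGroup Z']
  [LocallyCompactSpace Z'] [SecondCountableTopology Z']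
  [MeasurableSpace Z] [BorelSpace Z] [MeasurableSpace Z'] [BorelSpace Z']

/-- **Canonically normalised torus measures correspond under ANY isomorphism of topological groups**: for `e : Z ≃ₜ* Z′` and Haar measures `t`,
`t′` with `t(compactCore Z) = 1`, `t′(compactCore Z′) = 1`: `e_* t = t′`.  (`e_* t` and `t′` are proportional — Mathlib `isMulLeftInvariant_eq_smul`
— and both give the compact core outer measure `1`, ★ `image_compactCore`; no measurability, compactness or openness of the core is used.)
[cite: Rogawski1990, §4.3 p. 43] [cite: LanglandsShelstad1987, §1.3] -/
theorem map_eq_of_apply_compactCore_eq_one' (e : Z ≃ₜ* Z') (t : Measure Z) [t.IsHaarMeasure] (t' : Measure Z') [t'.IsHaarMeasure]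
    (ht : t (compactCore Z) = 1) (ht' : t' (compactCore Z') = 1) : Measure.map e t = t' := by
  haveI : (Measure.map e t).IsHaarMeasure := MulEquiv.isHaarMeasure_map t e.toMulEquiv e.continuous e.symm.continuous
  have h1 : Measure.map e t (compactCore Z') = 1 := by
    have hco : (⇑e : Z → Z') = ⇑(e.toHomeomorph.toMeasurableEquiv) := rfl
    have hpre : ⇑e ⁻¹' compactCore Z' = compactCore Z := by
      rw [← image_compactCore e]; exact e.injective.preimage_image _
    rw [hco, MeasurableEquiv.map_apply, ← hco, hpre, ht]
  have hs := Measure.isMulLeftInvariant_eq_smul (Measure.map e t) t'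
  have hκ : Measure.haarScalarFactor (Measure.map e t) t' = 1 := by
    have h2 := congrArg (fun m : Measure Z' => m (compactCore Z')) hs
    simp only [Measure.smul_apply, ENNReal.smul_def, smul_eq_mul, h1, ht', mul_one] at h2
    exact ENNReal.coe_eq_one.1 h2.symm
  rw [hs, hκ, one_smul]

end TransportOne

/-! ## §2 (δ4-CM) from the kit's facts -/

namespace UnitaryGroup

variable (L : Type) [Field L] [NumberField L] [IsCMField L] (N : ℕ) (H H' : Matrix (Fin N) (Fin N) L)

section Coherence

variable {γ : (cmDatum L N H).Rational} {γ' : (cmDatum L N H').Rational}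
  [∀ v, MeasurableSpace (↥(localPi L (IsCMField.complexConj L) N H v))] [∀ v, BorelSpace (↥(localPi L (IsCMField.complexConj L) N H v))] [∀ v, SecondCountableTopology (↥(localPi L (IsCMField.complexConj L) N H v))]
  [BorelSpace (Πʳ v : HeightOneSpectrum (𝓞 ↥(maximalRealSubfield L)), [↥(localPi L (IsCMField.complexConj L) N H v), localInt L (IsCMField.complexConj L) N H v])]
  [hKc : ∀ v, CompactSpace (localInt L (IsCMField.complexConj L) N H v)]
  [MeasurableSpace (finAdelic (↥(maximalRealSubfield L)) L (IsCMField.complexConj L) N H)] [BorelSpace (finAdelic (↥(maximalRealSubfield L)) L (IsCMField.complexConj L) N H)] [SecondCountableTopology (finAdelic (↥(maximalRealSubfield L)) L (IsCMField.complexConj L) N H)]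
  [MeasurableSpace (arch (↥(maximalRealSubfield L)) L (IsCMField.complexConj L) N H)] [BorelSpace (arch (↥(maximalRealSubfield L)) L (IsCMField.complexConj L) N H)]
  [MeasurableSpace (cmDatum L N H).Adelic] [BorelSpace (cmDatum L N H).Adelic]
  [∀ v, MeasurableSpace (↥(localPi L (IsCMField.complexConj L) N H' v))] [∀ v, BorelSpace (↥(localPi L (IsCMField.complexConj L) N H' v))] [∀ v, SecondCountableTopology (↥(localPi L (IsCMField.complexConj L) N H' v))]
  [BorelSpace (Πʳ v : HeightOneSpectrum (𝓞 ↥(maximalRealSubfield L)), [↥(localPi L (IsCMField.complexConj L) N H' v), localInt L (IsCMField.complexConj L) N H' v])]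
  [hKc' : ∀ v, CompactSpace (localInt L (IsCMField.complexConj L) N H' v)]
  [MeasurableSpace (finAdelic (↥(maximalRealSubfield L)) L (IsCMField.complexConj L) N H')] [BorelSpace (finAdelic (↥(maximalRealSubfield L)) L (IsCMField.complexConj L) N H')] [SecondCountableTopology (finAdelic (↥(maximalRealSubfield L)) L (IsCMField.complexConj L) N H')]
  [MeasurableSpace (arch (↥(maximalRealSubfield L)) L (IsCMField.complexConj L) N H')] [BorelSpace (arch (↥(maximalRealSubfield L)) L (IsCMField.complexConj L) N H')]
  [MeasurableSpace (cmDatum L N H').Adelic] [BorelSpace (cmDatum L N H').Adelic]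


set_option maxHeartbeats 3200000 in
set_option synthInstance.maxHeartbeats 400000 in
-- HB: as for ★ (δ4-CM) itself — two torus towers in the statement (measured there: 1.6 M times out at `whnf`, 3.2 M passes)
/-- **(δ4-CM) from the kit's facts.**  ★ `map_adelicStableCentralizerEquiv_torusMeasure_eq` with its coherence inputs discharged: the model-local torus
measures of both towers give their compact cores mass one (`ht1c`, `ht1c′` — the canonical normalisation of pin (xi‴), transported; §1 then gives `hQ` at
EVERY place), the integral subgroups are the compact cores off finite sets (`hF`, `hF′` = ★ `CompactCoreCentralizerLevelAE`, via ★
`eventually_inH_localInt_eq_compactCore`), and the archimedean transport is ★ `archStableCentralizerEquiv` at the points `(γ ⊗ 1)_∞ ↔ (γ′ ⊗ 1)_∞`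
(`hcinf`, `hreginf`), whose compatibility `hPa` with ★ `adelicStableCentralizerEquiv` is ★ `archPart_adelicStableCentralizerEquiv` up to the base-point
change ★ `archPart_cmDatum_toAdelic`; only `ha : (e_∞)_* t_∞ = t′_∞` remains (pin (xii) (C′) after ★ `OrbitalMeasureQuotientOfPointHaarChange`).  THEN
`(e_𝔸)_* t_𝔸 = t′_𝔸`. [cite: Rogawski1990, §4.3 pp. 43–44; §14.5 pp. 237–238] [cite: LanglandsShelstad1987, §1.3] -/
theorem map_adelicStableCentralizerEquiv_torusMeasure_eq_of_compactCore (hH : H.det ≠ 0) (hH' : H'.det ≠ 0)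
    (hc : Corresponds (cmConjRingHom L) H H' γ γ') (hreg : IsRegularElt (γ.val : GL (Fin N) L))
    [hCP : ∀ v, IsClosed (((Subgroup.centralizer ({((finAdelicEquiv (↥(maximalRealSubfield L)) L (IsCMField.complexConj L) N H) (finPart (↥(maximalRealSubfield L)) L (IsCMField.complexConj L) N H ((cmDatum L N H).toAdelic γ))) v} : Set ↥(localPi L (IsCMField.complexConj L) N H v))) : Subgroup ↥(localPi L (IsCMField.complexConj L) N H v)) : Set ↥(localPi L (IsCMField.complexConj L) N H v))]
    (t : ∀ v, Measure (Subgroup.centralizer ({((finAdelicEquiv (↥(maximalRealSubfield L)) L (IsCMField.complexConj L) N H) (finPart (↥(maximalRealSubfield L)) L (IsCMField.complexConj L) N H ((cmDatum L N H).toAdelic γ))) v} : Set ↥(localPi L (IsCMField.complexConj L) N H v)))) [∀ v, (t v).IsMulLeftInvariant] [∀ v, IsFiniteMeasureOnCompacts (t v)]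
    [∀ v, (t v).IsOpenPosMeasure] [∀ v, SigmaFinite (t v)]
    (S : Finset (HeightOneSpectrum (𝓞 ↥(maximalRealSubfield L))))
    (ρ : Measure (cutout (fun v => localInt L (IsCMField.complexConj L) N H v) (fun v => Subgroup.centralizer ({((finAdelicEquiv (↥(maximalRealSubfield L)) L (IsCMField.complexConj L) N H) (finPart (↥(maximalRealSubfield L)) L (IsCMField.complexConj L) N H ((cmDatum L N H).toAdelic γ))) v} : Set ↥(localPi L (IsCMField.complexConj L) N H v))) : Subgroup (Πʳ v : HeightOneSpectrum (𝓞 ↥(maximalRealSubfield L)), [↥(localPi L (IsCMField.complexConj L) N H v), localInt L (IsCMField.complexConj L) N H v])))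
    (ρM : Measure (Subgroup.centralizer ({((finAdelicEquiv (↥(maximalRealSubfield L)) L (IsCMField.complexConj L) N H) (finPart (↥(maximalRealSubfield L)) L (IsCMField.complexConj L) N H ((cmDatum L N H).toAdelic γ)))} : Set (Πʳ v : HeightOneSpectrum (𝓞 ↥(maximalRealSubfield L)), [↥(localPi L (IsCMField.complexConj L) N H v), localInt L (IsCMField.complexConj L) N H v]))))
    (tf : Measure (Subgroup.centralizer ({(finPart (↥(maximalRealSubfield L)) L (IsCMField.complexConj L) N H ((cmDatum L N H).toAdelic γ))} : Set (finAdelic (↥(maximalRealSubfield L)) L (IsCMField.complexConj L) N H)))) [SFinite tf]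
    (ti : Measure (Subgroup.centralizer ({(archPart (↥(maximalRealSubfield L)) L (IsCMField.complexConj L) N H ((cmDatum L N H).toAdelic γ))} : Set (arch (↥(maximalRealSubfield L)) L (IsCMField.complexConj L) N H)))) [SFinite ti]
    (tP : Measure ((Subgroup.centralizer ({(archPart (↥(maximalRealSubfield L)) L (IsCMField.complexConj L) N H ((cmDatum L N H).toAdelic γ))} : Set (arch (↥(maximalRealSubfield L)) L (IsCMField.complexConj L) N H))).prod (Subgroup.centralizer ({(finPart (↥(maximalRealSubfield L)) L (IsCMField.complexConj L) N H ((cmDatum L N H).toAdelic γ))} : Set (finAdelic (↥(maximalRealSubfield L)) L (IsCMField.complexConj L) N H)))))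
    (tA : Measure (Subgroup.centralizer ({((cmDatum L N H).toAdelic γ)} : Set (cmDatum L N H).Adelic)))
    (e : arch (↥(maximalRealSubfield L)) L (IsCMField.complexConj L) N H × finAdelic (↥(maximalRealSubfield L)) L (IsCMField.complexConj L) N H ≃* (cmDatum L N H).Adelic)
    (hee : e = (adelicProdEquiv (↥(maximalRealSubfield L)) L (IsCMField.complexConj L) N H).symm.toMulEquiv) (he : Continuous e) (hes : Continuous e.symm)
    (hg : e ((archPart (↥(maximalRealSubfield L)) L (IsCMField.complexConj L) N H ((cmDatum L N H).toAdelic γ)), (finPart (↥(maximalRealSubfield L)) L (IsCMField.complexConj L) N H ((cmDatum L N H).toAdelic γ))) = ((cmDatum L N H).toAdelic γ))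
    [hCP' : ∀ v, IsClosed (((Subgroup.centralizer ({((finAdelicEquiv (↥(maximalRealSubfield L)) L (IsCMField.complexConj L) N H') (finPart (↥(maximalRealSubfield L)) L (IsCMField.complexConj L) N H' ((cmDatum L N H').toAdelic γ'))) v} : Set ↥(localPi L (IsCMField.complexConj L) N H' v))) : Subgroup ↥(localPi L (IsCMField.complexConj L) N H' v)) : Set ↥(localPi L (IsCMField.complexConj L) N H' v))]
    (t' : ∀ v, Measure (Subgroup.centralizer ({((finAdelicEquiv (↥(maximalRealSubfield L)) L (IsCMField.complexConj L) N H') (finPart (↥(maximalRealSubfield L)) L (IsCMField.complexConj L) N H' ((cmDatum L N H').toAdelic γ'))) v} : Set ↥(localPi L (IsCMField.complexConj L) N H' v)))) [∀ v, (t' v).IsMulLeftInvariant] [∀ v, IsFiniteMeasureOnCompacts (t' v)]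
    [∀ v, (t' v).IsOpenPosMeasure] [∀ v, SigmaFinite (t' v)]
    (S' : Finset (HeightOneSpectrum (𝓞 ↥(maximalRealSubfield L))))
    (ρ' : Measure (cutout (fun v => localInt L (IsCMField.complexConj L) N H' v) (fun v => Subgroup.centralizer ({((finAdelicEquiv (↥(maximalRealSubfield L)) L (IsCMField.complexConj L) N H') (finPart (↥(maximalRealSubfield L)) L (IsCMField.complexConj L) N H' ((cmDatum L N H').toAdelic γ'))) v} : Set ↥(localPi L (IsCMField.complexConj L) N H' v))) : Subgroup (Πʳ v : HeightOneSpectrum (𝓞 ↥(maximalRealSubfield L)), [↥(localPi L (IsCMField.complexConj L) N H' v), localInt L (IsCMField.complexConj L) N H' v])))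
    (ρM' : Measure (Subgroup.centralizer ({((finAdelicEquiv (↥(maximalRealSubfield L)) L (IsCMField.complexConj L) N H') (finPart (↥(maximalRealSubfield L)) L (IsCMField.complexConj L) N H' ((cmDatum L N H').toAdelic γ')))} : Set (Πʳ v : HeightOneSpectrum (𝓞 ↥(maximalRealSubfield L)), [↥(localPi L (IsCMField.complexConj L) N H' v), localInt L (IsCMField.complexConj L) N H' v]))))
    (tf' : Measure (Subgroup.centralizer ({(finPart (↥(maximalRealSubfield L)) L (IsCMField.complexConj L) N H' ((cmDatum L N H').toAdelic γ'))} : Set (finAdelic (↥(maximalRealSubfield L)) L (IsCMField.complexConj L) N H')))) [SFinite tf']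
    (ti' : Measure (Subgroup.centralizer ({(archPart (↥(maximalRealSubfield L)) L (IsCMField.complexConj L) N H' ((cmDatum L N H').toAdelic γ'))} : Set (arch (↥(maximalRealSubfield L)) L (IsCMField.complexConj L) N H')))) [SFinite ti']
    (tP' : Measure ((Subgroup.centralizer ({(archPart (↥(maximalRealSubfield L)) L (IsCMField.complexConj L) N H' ((cmDatum L N H').toAdelic γ'))} : Set (arch (↥(maximalRealSubfield L)) L (IsCMField.complexConj L) N H'))).prod (Subgroup.centralizer ({(finPart (↥(maximalRealSubfield L)) L (IsCMField.complexConj L) N H' ((cmDatum L N H').toAdelic γ'))} : Set (finAdelic (↥(maximalRealSubfield L)) L (IsCMField.complexConj L) N H')))))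
    (tA' : Measure (Subgroup.centralizer ({((cmDatum L N H').toAdelic γ')} : Set (cmDatum L N H').Adelic)))
    (e' : arch (↥(maximalRealSubfield L)) L (IsCMField.complexConj L) N H' × finAdelic (↥(maximalRealSubfield L)) L (IsCMField.complexConj L) N H' ≃* (cmDatum L N H').Adelic)
    (hee' : e' = (adelicProdEquiv (↥(maximalRealSubfield L)) L (IsCMField.complexConj L) N H').symm.toMulEquiv) (he' : Continuous e') (hes' : Continuous e'.symm)
    (hg' : e' ((archPart (↥(maximalRealSubfield L)) L (IsCMField.complexConj L) N H' ((cmDatum L N H').toAdelic γ')), (finPart (↥(maximalRealSubfield L)) L (IsCMField.complexConj L) N H' ((cmDatum L N H').toAdelic γ'))) = ((cmDatum L N H').toAdelic γ'))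
    (ht1 : ∀ v, v ∉ S → t v ((inH (fun v => localInt L (IsCMField.complexConj L) N H v) (fun v => Subgroup.centralizer ({((finAdelicEquiv (↥(maximalRealSubfield L)) L (IsCMField.complexConj L) N H) (finPart (↥(maximalRealSubfield L)) L (IsCMField.complexConj L) N H ((cmDatum L N H).toAdelic γ))) v} : Set ↥(localPi L (IsCMField.complexConj L) N H v))) v : Subgroup (Subgroup.centralizer ({((finAdelicEquiv (↥(maximalRealSubfield L)) L (IsCMField.complexConj L) N H) (finPart (↥(maximalRealSubfield L)) L (IsCMField.complexConj L) N H ((cmDatum L N H).toAdelic γ))) v} : Set ↥(localPi L (IsCMField.complexConj L) N H v)))) : Set (Subgroup.centralizer ({((finAdelicEquiv (↥(maximalRealSubfield L)) L (IsCMField.complexConj L) N H) (finPart (↥(maximalRealSubfield L)) L (IsCMField.complexConj L) N H ((cmDatum L N H).toAdelic γ))) v} : Set ↥(localPi L (IsCMField.complexConj L) N H v)))) = 1)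
    (hρ : ρ = Measure.map (cutoutEquiv (fun v => localInt L (IsCMField.complexConj L) N H v) (fun v => Subgroup.centralizer ({((finAdelicEquiv (↥(maximalRealSubfield L)) L (IsCMField.complexConj L) N H) (finPart (↥(maximalRealSubfield L)) L (IsCMField.complexConj L) N H ((cmDatum L N H).toAdelic γ))) v} : Set ↥(localPi L (IsCMField.complexConj L) N H v))))
      (rpMeasure (fun v => ((inH (fun v => localInt L (IsCMField.complexConj L) N H v) (fun v => Subgroup.centralizer ({((finAdelicEquiv (↥(maximalRealSubfield L)) L (IsCMField.complexConj L) N H) (finPart (↥(maximalRealSubfield L)) L (IsCMField.complexConj L) N H ((cmDatum L N H).toAdelic γ))) v} : Set ↥(localPi L (IsCMField.complexConj L) N H v))) v : Subgroup (Subgroup.centralizer ({((finAdelicEquiv (↥(maximalRealSubfield L)) L (IsCMField.complexConj L) N H) (finPart (↥(maximalRealSubfield L)) L (IsCMField.complexConj L) N H ((cmDatum L N H).toAdelic γ))) v} : Set ↥(localPi L (IsCMField.complexConj L) N H v)))) : Set (Subgroup.centralizer ({((finAdelicEquiv (↥(maximalRealSubfield L)) L (IsCMField.complexConj L) N H) (finPart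 (↥(maximalRealSubfield L)) L (IsCMField.complexConj L) N H ((cmDatum L N H).toAdelic γ))) v} : Set ↥(localPi L (IsCMField.complexConj L) N H v))))) t S))
    (hρM : ρM = Measure.map (subgroupCongrHomeomorph (MulEquiv.refl (Πʳ v : HeightOneSpectrum (𝓞 ↥(maximalRealSubfield L)), [↥(localPi L (IsCMField.complexConj L) N H v), localInt L (IsCMField.complexConj L) N H v]))
      (cutout (fun v => localInt L (IsCMField.complexConj L) N H v) (fun v => Subgroup.centralizer ({((finAdelicEquiv (↥(maximalRealSubfield L)) L (IsCMField.complexConj L) N H) (finPart (↥(maximalRealSubfield L)) L (IsCMField.complexConj L) N H ((cmDatum L N H).toAdelic γ))) v} : Set ↥(localPi L (IsCMField.complexConj L) N H v)))) (Subgroup.centralizer ({((finAdelicEquiv (↥(maximalRealSubfield L)) L (IsCMField.complexConj L) N H) (finPart (↥(maximalRealSubfield L)) L (IsCMField.complexConj L) N H ((cmDatum L N H).toAdelic γ)))} : Set (Πʳ v : HeightOneSpectrum (𝓞 ↥(maximalRealSubfield L)), [↥(localPi L (IsCMField.complexConj L) N H v), localInt L (IsCMField.complexConj L) N H v])))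
      (forall_refl_mem_iff (fun v => localInt L (IsCMField.complexConj L) N H v) (fun v => Subgroup.centralizer ({((finAdelicEquiv (↥(maximalRealSubfield L)) L (IsCMField.complexConj L) N H) (finPart (↥(maximalRealSubfield L)) L (IsCMField.complexConj L) N H ((cmDatum L N H).toAdelic γ))) v} : Set ↥(localPi L (IsCMField.complexConj L) N H v))) _ (mem_centralizer_singleton_iff_forall_mem (fun v => localInt L (IsCMField.complexConj L) N H v) ((finAdelicEquiv (↥(maximalRealSubfield L)) L (IsCMField.complexConj L) N H) (finPart (↥(maximalRealSubfield L)) L (IsCMField.complexConj L) N H ((cmDatum L N H).toAdelic γ)))))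
      continuous_id continuous_id) ρ)
    (htf : tf = Measure.map (subgroupCongrHomeomorph (finAdelicEquiv (↥(maximalRealSubfield L)) L (IsCMField.complexConj L) N H).symm.toMulEquiv (Subgroup.centralizer ({((finAdelicEquiv (↥(maximalRealSubfield L)) L (IsCMField.complexConj L) N H) (finPart (↥(maximalRealSubfield L)) L (IsCMField.complexConj L) N H ((cmDatum L N H).toAdelic γ)))} : Set (Πʳ v : HeightOneSpectrum (𝓞 ↥(maximalRealSubfield L)), [↥(localPi L (IsCMField.complexConj L) N H v), localInt L (IsCMField.complexConj L) N H v]))) (Subgroup.centralizer ({(finPart (↥(maximalRealSubfield L)) L (IsCMField.complexConj L) N H ((cmDatum L N H).toAdelic γ))} : Set (finAdelic (↥(maximalRealSubfield L)) L (IsCMField.complexConj L) N H)))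
      (forall_apply_mem_centralizer_singleton_iff_of_eq (finAdelicEquiv (↥(maximalRealSubfield L)) L (IsCMField.complexConj L) N H).symm.toMulEquiv ((finAdelicEquiv (↥(maximalRealSubfield L)) L (IsCMField.complexConj L) N H).symm_apply_apply (finPart (↥(maximalRealSubfield L)) L (IsCMField.complexConj L) N H ((cmDatum L N H).toAdelic γ))))
      (finAdelicEquiv (↥(maximalRealSubfield L)) L (IsCMField.complexConj L) N H).symm.continuous (finAdelicEquiv (↥(maximalRealSubfield L)) L (IsCMField.complexConj L) N H).continuous) ρM)
    (htP : Measure.map (Subgroup.prodEquiv (Subgroup.centralizer ({(archPart (↥(maximalRealSubfield L)) L (IsCMField.complexConj L) N H ((cmDatum L N H).toAdelic γ))} : Set (arch (↥(maximalRealSubfield L)) L (IsCMField.complexConj L) N H))) (Subgroup.centralizer ({(finPart (↥(maximalRealSubfield L)) L (IsCMField.complexConj L) N H ((cmDatum L N H).toAdelic γ))} : Set (finAdelic (↥(maximalRealSubfield L)) L (IsCMField.complexConj L) N H)))) tP = ti.prod tf)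
    (htA : tA = Measure.map (subgroupCongrHomeomorph e ((Subgroup.centralizer ({(archPart (↥(maximalRealSubfield L)) L (IsCMField.complexConj L) N H ((cmDatum L N H).toAdelic γ))} : Set (arch (↥(maximalRealSubfield L)) L (IsCMField.complexConj L) N H))).prod (Subgroup.centralizer ({(finPart (↥(maximalRealSubfield L)) L (IsCMField.complexConj L) N H ((cmDatum L N H).toAdelic γ))} : Set (finAdelic (↥(maximalRealSubfield L)) L (IsCMField.complexConj L) N H)))) (Subgroup.centralizer ({((cmDatum L N H).toAdelic γ)} : Set (cmDatum L N H).Adelic)) (forall_apply_mem_centralizer_iff e hg) he hes) tP)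
    (ht1' : ∀ v, v ∉ S' → t' v ((inH (fun v => localInt L (IsCMField.complexConj L) N H' v) (fun v => Subgroup.centralizer ({((finAdelicEquiv (↥(maximalRealSubfield L)) L (IsCMField.complexConj L) N H') (finPart (↥(maximalRealSubfield L)) L (IsCMField.complexConj L) N H' ((cmDatum L N H').toAdelic γ'))) v} : Set ↥(localPi L (IsCMField.complexConj L) N H' v))) v : Subgroup (Subgroup.centralizer ({((finAdelicEquiv (↥(maximalRealSubfield L)) L (IsCMField.complexConj L) N H') (finPart (↥(maximalRealSubfield L)) L (IsCMField.complexConj L) N H' ((cmDatum L N H').toAdelic γ'))) v} : Set ↥(localPi L (IsCMField.complexConj L) N H' v)))) : Set (Subgroup.centralizer ({((finAdelicEquiv (↥(maximalRealSubfield L)) L (IsCMField.complexConj L) N H') (finPart (↥(maximalRealSubfield L)) L (IsCMField.complexConj L) N H' ((cmDatum L N H').toAdelic γ'))) v} : Set ↥(localPi L (IsCMField.complexConj L) N H' v)))) = 1)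
    (hρ' : ρ' = Measure.map (cutoutEquiv (fun v => localInt L (IsCMField.complexConj L) N H' v) (fun v => Subgroup.centralizer ({((finAdelicEquiv (↥(maximalRealSubfield L)) L (IsCMField.complexConj L) N H') (finPart (↥(maximalRealSubfield L)) L (IsCMField.complexConj L) N H' ((cmDatum L N H').toAdelic γ'))) v} : Set ↥(localPi L (IsCMField.complexConj L) N H' v))))
      (rpMeasure (fun v => ((inH (fun v => localInt L (IsCMField.complexConj L) N H' v) (fun v => Subgroup.centralizer ({((finAdelicEquiv (↥(maximalRealSubfield L)) L (IsCMField.complexConj L) N H') (finPart (↥(maximalRealSubfield L)) L (IsCMField.complexConj L) N H' ((cmDatum L N H').toAdelic γ'))) v} : Set ↥(localPi L (IsCMField.complexConj L) N H' v))) v : Subgroup (Subgroup.centralizer ({((finAdelicEquiv (↥(maximalRealSubfield L)) L (IsCMField.complexConj L) N H') (finPart (↥(maximalRealSubfield L)) L (IsCMField.complexConj L) N H' ((cmDatum L N H').toAdelic γ'))) v} : Set ↥(localPi L (IsCMField.complexConj L) N H' v)))) : Set (Subgroup.centralizer ({((finAdelicEquiv (↥(maximalRealSubfield L)) L (IsCMField.complexConj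 L) N H') (finPart (↥(maximalRealSubfield L)) L (IsCMField.complexConj L) N H' ((cmDatum L N H').toAdelic γ'))) v} : Set ↥(localPi L (IsCMField.complexConj L) N H' v))))) t' S'))
    (hρM' : ρM' = Measure.map (subgroupCongrHomeomorph (MulEquiv.refl (Πʳ v : HeightOneSpectrum (𝓞 ↥(maximalRealSubfield L)), [↥(localPi L (IsCMField.complexConj L) N H' v), localInt L (IsCMField.complexConj L) N H' v]))
      (cutout (fun v => localInt L (IsCMField.complexConj L) N H' v) (fun v => Subgroup.centralizer ({((finAdelicEquiv (↥(maximalRealSubfield L)) L (IsCMField.complexConj L) N H') (finPart (↥(maximalRealSubfield L)) L (IsCMField.complexConj L) N H' ((cmDatum L N H').toAdelic γ'))) v} : Set ↥(localPi L (IsCMField.complexConj L) N H' v)))) (Subgroup.centralizer ({((finAdelicEquiv (↥(maximalRealSubfield L)) L (IsCMField.complexConj L) N H') (finPart (↥(maximalRealSubfield L)) L (IsCMField.complexConj L) N H' ((cmDatum L N H').toAdelic γ')))} : Set (Πʳ v : HeightOneSpectrum (𝓞 ↥(maximalRealSubfield L)), [↥(localPi L (IsCMField.complexConj L) N H' v),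 localInt L (IsCMField.complexConj L) N H' v])))
      (forall_refl_mem_iff (fun v => localInt L (IsCMField.complexConj L) N H' v) (fun v => Subgroup.centralizer ({((finAdelicEquiv (↥(maximalRealSubfield L)) L (IsCMField.complexConj L) N H') (finPart (↥(maximalRealSubfield L)) L (IsCMField.complexConj L) N H' ((cmDatum L N H').toAdelic γ'))) v} : Set ↥(localPi L (IsCMField.complexConj L) N H' v))) _ (mem_centralizer_singleton_iff_forall_mem (fun v => localInt L (IsCMField.complexConj L) N H' v) ((finAdelicEquiv (↥(maximalRealSubfield L)) L (IsCMField.complexConj L) N H') (finPart (↥(maximalRealSubfield L)) L (IsCMField.complexConj L) N H' ((cmDatum L N H').toAdelic γ')))))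
      continuous_id continuous_id) ρ')
    (htf' : tf' = Measure.map (subgroupCongrHomeomorph (finAdelicEquiv (↥(maximalRealSubfield L)) L (IsCMField.complexConj L) N H').symm.toMulEquiv (Subgroup.centralizer ({((finAdelicEquiv (↥(maximalRealSubfield L)) L (IsCMField.complexConj L) N H') (finPart (↥(maximalRealSubfield L)) L (IsCMField.complexConj L) N H' ((cmDatum L N H').toAdelic γ')))} : Set (Πʳ v : HeightOneSpectrum (𝓞 ↥(maximalRealSubfield L)), [↥(localPi L (IsCMField.complexConj L) N H' v), localInt L (IsCMField.complexConj L) N H' v]))) (Subgroup.centralizer ({(finPart (↥(maximalRealSubfield L)) L (IsCMField.complexConj L) N H' ((cmDatum L N H').toAdelic γ'))} : Set (finAdelic (↥(maximalRealSubfield L)) L (IsCMField.complexConj L) N H')))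
      (forall_apply_mem_centralizer_singleton_iff_of_eq (finAdelicEquiv (↥(maximalRealSubfield L)) L (IsCMField.complexConj L) N H').symm.toMulEquiv ((finAdelicEquiv (↥(maximalRealSubfield L)) L (IsCMField.complexConj L) N H').symm_apply_apply (finPart (↥(maximalRealSubfield L)) L (IsCMField.complexConj L) N H' ((cmDatum L N H').toAdelic γ'))))
      (finAdelicEquiv (↥(maximalRealSubfield L)) L (IsCMField.complexConj L) N H').symm.continuous (finAdelicEquiv (↥(maximalRealSubfield L)) L (IsCMField.complexConj L) N H').continuous) ρM')
    (htP' : Measure.map (Subgroup.prodEquiv (Subgroup.centralizer ({(archPart (↥(maximalRealSubfield L)) L (IsCMField.complexConj L) N H' ((cmDatum L N H').toAdelic γ'))} : Set (arch (↥(maximalRealSubfield L)) L (IsCMField.complexConj L) N H'))) (Subgroup.centralizer ({(finPart (↥(maximalRealSubfield L)) L (IsCMField.complexConj L) N H' ((cmDatum L N H').toAdelic γ'))} : Set (finAdelic (↥(maximalRealSubfield L)) L (IsCMField.complexConj L) N H')))) tP' = ti'.prod tf')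
    (htA' : tA' = Measure.map (subgroupCongrHomeomorph e' ((Subgroup.centralizer ({(archPart (↥(maximalRealSubfield L)) L (IsCMField.complexConj L) N H' ((cmDatum L N H').toAdelic γ'))} : Set (arch (↥(maximalRealSubfield L)) L (IsCMField.complexConj L) N H'))).prod (Subgroup.centralizer ({(finPart (↥(maximalRealSubfield L)) L (IsCMField.complexConj L) N H' ((cmDatum L N H').toAdelic γ'))} : Set (finAdelic (↥(maximalRealSubfield L)) L (IsCMField.complexConj L) N H')))) (Subgroup.centralizer ({((cmDatum L N H').toAdelic γ')} : Set (cmDatum L N H').Adelic)) (forall_apply_mem_centralizer_iff e' hg') he' hes') tP')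
    -- the kit's inputs in place of (δ4-CM)'s `hQ hK hK′ Pa hPam ha hPa`
    [∀ v, LocallyCompactSpace (↥(localPi L (IsCMField.complexConj L) N H' v))]
    (hF : CompactCoreCentralizerLevelAE L N H) (hF' : CompactCoreCentralizerLevelAE L N H')
    (ht1c : ∀ v, t v (compactCore (Subgroup.centralizer ({((finAdelicEquiv (↥(maximalRealSubfield L)) L (IsCMField.complexConj L) N H) (finPart (↥(maximalRealSubfield L)) L (IsCMField.complexConj L) N H ((cmDatum L N H).toAdelic γ))) v} : Set ↥(localPi L (IsCMField.complexConj L) N H v)))) = 1)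
    (ht1c' : ∀ v, t' v (compactCore (Subgroup.centralizer ({((finAdelicEquiv (↥(maximalRealSubfield L)) L (IsCMField.complexConj L) N H') (finPart (↥(maximalRealSubfield L)) L (IsCMField.complexConj L) N H' ((cmDatum L N H').toAdelic γ'))) v} : Set ↥(localPi L (IsCMField.complexConj L) N H' v)))) = 1)
    (hreginf : IsRegularElt ((archPart (↥(maximalRealSubfield L)) L (IsCMField.complexConj L) N H ((cmDatum L N H).toAdelic γ)).val : GL (Fin N) (mixedEmbedding.mixedSpace L)))
    (hcinf : Corresponds (conjMixed (↥(maximalRealSubfield L)) L (IsCMField.complexConj L)) (archFormOf L N H) (archFormOf L N H')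
      (archPart (↥(maximalRealSubfield L)) L (IsCMField.complexConj L) N H ((cmDatum L N H).toAdelic γ))
      (archPart (↥(maximalRealSubfield L)) L (IsCMField.complexConj L) N H' ((cmDatum L N H').toAdelic γ')))
    (ha : Measure.map (archStableCentralizerEquiv L hH hH' hcinf hreginf) ti = ti') :
    Measure.map (adelicStableCentralizerEquiv L hH hH' hc hreg) tA = tA' := by
  -- `hK`, `hK′`: the integral subgroups are the compact cores off a finite set
  have hreg' : IsRegularElt (γ'.val : GL (Fin N) L) := isRegularElt_of_isConj hc hreg
  have hK := eventually_inH_localInt_eq_compactCore L N H hF γ hreg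
  have hK' := eventually_inH_localInt_eq_compactCore L N H' hF' γ' hreg'
  -- `hQ`: canonically normalised model-local torus measures correspond under ANY isomorphism (§1)
  have hQ : ∀ v (Q : (Subgroup.centralizer ({((finAdelicEquiv (↥(maximalRealSubfield L)) L (IsCMField.complexConj L) N H) (finPart (↥(maximalRealSubfield L)) L (IsCMField.complexConj L) N H ((cmDatum L N H).toAdelic γ))) v} : Set ↥(localPi L (IsCMField.complexConj L) N H v))) ≃ₜ* (Subgroup.centralizer ({((finAdelicEquiv (↥(maximalRealSubfield L)) L (IsCMField.complexConj L) N H') (finPart (↥(maximalRealSubfield L)) L (IsCMField.complexConj L) N H' ((cmDatum L N H').toAdelic γ'))) v} : Set ↥(localPi L (IsCMField.complexConj L) N H' v)))), Measure.map Q (t v) = t' v := by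
    intro v Q
    haveI : LocallyCompactSpace (Subgroup.centralizer ({((finAdelicEquiv (↥(maximalRealSubfield L)) L (IsCMField.complexConj L) N H') (finPart (↥(maximalRealSubfield L)) L (IsCMField.complexConj L) N H' ((cmDatum L N H').toAdelic γ'))) v} : Set ↥(localPi L (IsCMField.complexConj L) N H' v))) :=
      (hCP' v).isClosedEmbedding_subtypeVal.locallyCompactSpace
    haveI : (t v).IsHaarMeasure :=
      { toIsFiniteMeasureOnCompacts := inferInstance, toIsMulLeftInvariant := inferInstance, toIsOpenPosMeasure := inferInstance }
    haveI : (t' v).IsHaarMeasure :=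
      { toIsFiniteMeasureOnCompacts := inferInstance, toIsMulLeftInvariant := inferInstance, toIsOpenPosMeasure := inferInstance }
    exact map_eq_of_apply_compactCore_eq_one' Q (t v) (t' v) (ht1c v) (ht1c' v)
  -- `Pa`, `hPam`, `hPa`: the archimedean component is `archStableCentralizerEquiv` at `(γ ⊗ 1)_∞`
  refine map_adelicStableCentralizerEquiv_torusMeasure_eq L N H H' hH hH' hc hreg t S ρ ρM tf ti tP tA e hee he hes hg t' S' ρ' ρM' tf' ti' tP' tA' e' hee' he' hes' hg'
    ht1 hρ hρM htf htP htA ht1' hρ' hρM' htf' htP' htA' hQ hK hK' (archStableCentralizerEquiv L hH hH' hcinf hreginf)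
    (archStableCentralizerEquiv L hH hH' hcinf hreginf).continuous.measurable ha (fun z hz => ?_)
  -- base-point change: both archimedean equivalences are conjugation by one ambient conjugator
  have h0 : archPart (↥(maximalRealSubfield L)) L (IsCMField.complexConj L) N H ((cmDatum L N H).toAdelic γ) = cmRationalToArch L N H γ :=
    archPart_cmDatum_toAdelic L N H γ
  have h0' : archPart (↥(maximalRealSubfield L)) L (IsCMField.complexConj L) N H' ((cmDatum L N H').toAdelic γ') = cmRationalToArch L N H' γ' :=
    archPart_cmDatum_toAdelic L N H' γ'
  have hreginf₀ : IsRegularElt ((cmRationalToArch L N H γ : arch (↥(maximalRealSubfield L)) L (IsCMField.complexConj L) N H).val : GL (Fin N) (mixedEmbedding.mixedSpace L)) :=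
    h0 ▸ hreginf
  rw [archPart_adelicStableCentralizerEquiv L hH hH' hc hreg hreginf₀ z]
  apply Subtype.ext
  have hy : hcinf.conjugator * ((archPart (↥(maximalRealSubfield L)) L (IsCMField.complexConj L) N H ((cmDatum L N H).toAdelic γ)).val : GL (Fin N) (mixedEmbedding.mixedSpace L)) * hcinf.conjugator⁻¹ =
      (archPart (↥(maximalRealSubfield L)) L (IsCMField.complexConj L) N H' ((cmDatum L N H').toAdelic γ')).val := hcinf.conjugator_spec
  have hy₀ : hcinf.conjugator * ((cmRationalToArch L N H γ : arch (↥(maximalRealSubfield L)) L (IsCMField.complexConj L) N H).val : GL (Fin N) (mixedEmbedding.mixedSpace L)) * hcinf.conjugator⁻¹ =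
      (cmRationalToArch L N H' γ' : arch (↥(maximalRealSubfield L)) L (IsCMField.complexConj L) N H').val := by
    rw [← h0, ← h0']; exact hy
  rw [coe_archStableCentralizerEquiv_eq_of_conj_eq L hH hH' (corresponds_cmRationalToArch hc) hreginf₀ hcinf.conjugator hy₀,
    coe_archStableCentralizerEquiv_eq_of_conj_eq L hH hH' hcinf hreginf hcinf.conjugator hy]

end Coherence

/-! ## §3 The archimedean input `ha` from pin (xii) (C′): transport commutes with the common Haar scalar -/

section ArchSmul

variable {H}
  [MeasurableSpace (arch (↥(maximalRealSubfield L)) L (IsCMField.complexConj L) N H)]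

/-- **`ha` for the pair step**: if the kit's archimedean torus measures `t'` are coherent along ★ `archStableCentralizerEquiv` (pin (xii) (C′): ANY proofs of
`det H ≠ 0`, regularity and correspondence — they are propositions), then so are their common rescalings `κ • t' γ` (the `ti = haarScalarFactor νi νGi • t' γ_∞`
of ★ `exists_atPoint_eq_quotientMeasure_of_isQuotientOf_of_archCoherent`, the SAME `κ` for both classes). [cite: Rogawski1990, §4.3 pp. 43–44; §1.7 p. 6] -/
theorem map_archStableCentralizerEquiv_nnreal_smul_eq (hH : H.det ≠ 0)
    {γ₁ γ₂ : arch (↥(maximalRealSubfield L)) L (IsCMField.complexConj L) N H}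
    (hc : Corresponds (conjMixed (↥(maximalRealSubfield L)) L (IsCMField.complexConj L)) (archFormOf L N H) (archFormOf L N H) γ₁ γ₂)
    (h₁ : IsRegularElt (γ₁.val : GL (Fin N) (mixedEmbedding.mixedSpace L)))
    (t₁ : Measure (Subgroup.centralizer ({γ₁} : Set (arch (↥(maximalRealSubfield L)) L (IsCMField.complexConj L) N H))))
    (t₂ : Measure (Subgroup.centralizer ({γ₂} : Set (arch (↥(maximalRealSubfield L)) L (IsCMField.complexConj L) N H))))
    (h : Measure.map (archStableCentralizerEquiv L hH hH hc h₁) t₁ = t₂) (κ : ℝ≥0) :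
    Measure.map (archStableCentralizerEquiv L hH hH hc h₁) (κ • t₁) = κ • t₂ := by
  rw [Measure.map_smul, h]

end ArchSmul

end UnitaryGroup

end Literature.NumberTheory.Automorphic
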